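/-
Copyright (c) 2026 the pub-hodgecm-mathlib formalisation cell (harness21).  Prover seat hodgecm-mathlib-K2Liu-p05 (g3), 2026-09-04
(Track B «K2-LIT», crux hLiu418 = stmt-HodgeConjecture-24832, socket #42F′ `sig_K2LiuFirstTermIdentityOnGenerators`, ROAD I v3, organ G2-Weil
(SIGS-RoadI-v3 §G2; LEAD F0P6-plan (g12) DEAL 2026-09-04T06:44:18Z, K2E5-plan (g5) CUT 06:44:33Z), sub-organ (G2-W1) FILE 1∕2: DEFINITIONS + exponential table).
-/
import Literature.RepresentationTheory.KonnoKonno2007.JunctionLinearRealGroup   -- ★ `uFormGroup`, `torusGen`, `exp_smul_torusGen`, `rotW`, `phaseDiag`, U(2,1) template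
import HarnessLib

/-!
# (G2-W1, file 1∕2) An adapted basis of `𝔲(2,2)` — DEFINITIONS: the boost generators `Y_{pq}`, the letters, the sixteen `K`-conjugated
# generators `X_i = g_i X⁰_i g_i⁻¹`, and their exponential table `exp (s X_i) = g_i L_i(s) g_i⁻¹`

Track B ∕ K2-LIT, hLiu418 = stmt-HodgeConjecture-24832, #42F′ ROAD I v3 organ G2-Weil (infinitesimal arch Weil action), sub-organ (G2-W1): the
`U(2,2)` TWIN of ★ `Literature.RepresentationTheory.KonnoKonno2007.JunctionLinearRealGroup` §3 (which treats `U(2,1)` in the frame `Fin 2 ⊕ Unit`).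
Namespace `Summit.HodgeConjecture.HodgeConjecture.Cruxes.HLiu418.K2LiuU22AdaptedBasis`.  DEFINITIONS WITH BODIES + theorems (review lane
`--kind definition`; no instance, no notation, no attribute, no named fact, no `sorry`); `--supports stmt-HodgeConjecture-24832 --as helper`.

WHY (ROAD I v3, rulings M-156d∕e; census 2026-09-04T06:47Z on the squad bus).  The engine ★ `RealMatrixGroup.contDiffAt_apply_of_letters`
(`ArchimedeanSecondKindChart`) makes `x ↦ T (ω (c x) Φ)` smooth for a representation `ω` of a linear real group on a Schwartz space as soon as an
ℝ-basis `X_i` of its Lie algebra is given whose one-parameter groups `exp (s X_i)` are `K`-conjugates of PINNED LETTERS (boosts ★ `hypV p q`, compact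
tori) on which `ω` is known to act by smooth one-parameter families of Schwartz operators (★ `isSmoothOneParam_hypOp`, ★ `isSmoothOneParam_torusKOp`).
★ `JunctionArchDifferentiable.contDiffAt_weilDatum_inl` does this for `U(2,1)` from ★ `expMem_smul_u21AdaptedBasis`.  The archimedean group of the
doubled hermitian space `𝕍 ⊕ (−𝕍)` of #42F′ (`n = 2`) at a real place is `U(2,2)`; this file and its sequel supply the same two index functions + one
letter map for `uFormGroup (Fin 2) (Fin 2)`.

CONTENTS (frame `Fin 2 ⊕ Fin 2`, `D = diag(1,1,−1,−1)`, `K = U(2) × U(2)` through ★ `kV`):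
* §1 the BOOST GENERATORS `Y_{pq} = −i E_{p,q̄} + i E_{q̄,p}` (`boostGen p q`, `p q : Fin 2`; `q̄ = inr q`), diagonalised in the planted frame
  `plant p q (−i, i; 1, 1)` (`boostGenFrame`, `smul_boostGen_eq_conj`), whence **`exp (s · Y_{pq}) = hypV p q s`** (`exp_smul_boostGen`, ★ `coe_hypV`) and
  `Y_{pq} ∈ 𝔲(2,2)` (`boostGen_mem_lie`, by ★ `uFormGroup_regular`); the REAL BOOSTS `Z_{pq} = E_{p,q̄} + E_{q̄,p} = Ad(d_p) Y_{pq}` (`realBoostGen`).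
* §2 LETTERS: `LetterKind` = `boost p q | torus a b`, `letterOf` (`hypV p q`, resp. the compact torus `s ↦ kV (diag e^{−isa}, diag e^{−isb})`),
  `letterGen` (`Y_{pq}`, resp. ★ `torusGen a b`), `exp_smul_letterGen`.
* §3 THE SIXTEEN GENERATORS: kinds `u22Kind : Fin 16 → LetterKind` and `K`-frames `u22FrameK : Fin 16 → U(2) × U(2)` — tori `iE₀₀, iE₁₁, iE₂₂, iE₃₃`
  (frames `1`); the off-diagonal compact directions of each `U(2)` factor as `Ad(w)`, `Ad(d₁w)` of the torus `i(E₀₀ − E₁₁)` (resp. `i(E₂₂ − E₃₃)`),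
  `w = (1∕5)(3, 4; −4, 3)` (★ `rotW`), `d_p = diag(i at p)` (★ `phaseDiag`); the boosts `Y_{pq}` (frames `1`) and the real boosts `Z_{pq}` (frames
  `(d_p, 1)`); `u22Gen i = g_i X⁰_i g_i⁻¹ ∈ 𝔲(2,2)` and the EXPONENTIAL TABLE `exp (s X_i) = g_i L_i(s) g_i⁻¹` (`exp_smul_u22Gen`, `expGL_smul_u22Gen`,
  `expGL_smul_u22Gen_eq`, `expGL_smul_u22Gen_mem`).
File 2∕2 (`K2LiuU22AdaptedBasis.lean`): closed forms, linear independence, spanning, `u22AdaptedBasis : Module.Basis (Fin 16) ℝ 𝔲(2,2)`,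
`finrank = 16`, `expMem_smul_u22AdaptedBasis`.

HONEST LABEL: HC_CM is proved only modulo the 7 printed citations (2 remaining named inputs: hLiu418 = stmt-HodgeConjecture-24832, h413 =
stmt-HodgeConjecture-24833) until rung 0 closes; this file is organ capital (G2-W1) for #42F′'s Road I and moves no counter.

## References
* [Knapp2002] A. W. Knapp, *Lie Groups Beyond an Introduction*, 2nd ed. (2002), I.§1 Example (3) (`𝔲(p,q)`), VI.§2 (`𝔨 ⊕ 𝔭`), VII.§2 Example 2.
* [Folland1989] G. B. Folland, *Harmonic Analysis in Phase Space* (1989), §4.2 (4.24), Prop. (4.39).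
* [KonnoKonno2007] K. Konno, T. Konno, Kyushu J. Math. 61 (2007), §3.1 (the frame `U(α, β)`).
-/

set_option autoImplicit false
set_option linter.dupNamespace false

noncomputable section

open scoped MatrixGroups Matrix ComplexConjugate
open NormedSpace -- for `exp`
open Literature.NumberTheory.Automorphic
open Literature.RepresentationTheory.KonnoKonno2007
open Literature.RepresentationTheory.KonnoKonno2007.RealDualPair
open Literature.RepresentationTheory.KonnoKonno2007.RealDualPair.UForm
open Literature.Analysis.SegalBargmann
open Complex (I)

namespace Summit.HodgeConjecture.HodgeConjecture.Cruxes.HLiu418.K2LiuU22AdaptedBasis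

/-! ## §1 The boost generators `Y_{pq}` of `𝔲(2,2)` and their one-parameter groups `hypV p q` -/

section Boost

/-- **Boost generator** `Y_{pq} = −i E_{p,q̄} + i E_{q̄,p}` (`p q : Fin 2`; `q̄ = inr q` the index of the negative block): the velocity at
`s = 0` of the hyperbolic one-parameter group `s ↦ hypV p q s` of ★ `RealUnitaryRankOneKAK`. [cite: Knapp2002, VI.§2] -/
def boostGen (p q : Fin 2) : Matrix (Fin 2 ⊕ Fin 2) (Fin 2 ⊕ Fin 2) ℂ :=
  Matrix.of fun x y =>
    match x, y with
    | Sum.inl a, Sum.inr b => if a = p ∧ b = q then -I else 0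
    | Sum.inr b, Sum.inl a => if a = p ∧ b = q then I else 0
    | _, _ => 0

/-- `Y_{pq}` vanishes on the `α × α` block. [folklore] -/
@[simp] theorem boostGen_inl_inl (p q a a' : Fin 2) : boostGen p q (Sum.inl a) (Sum.inl a') = 0 := rfl

/-- `Y_{pq}` vanishes on the `β × β` block. [folklore] -/
@[simp] theorem boostGen_inr_inr (p q b b' : Fin 2) : boostGen p q (Sum.inr b) (Sum.inr b') = 0 := rfl

/-- the `(p, q̄)` entry of `Y_{pq}` is `−i`. [folklore] -/
@[simp] theorem boostGen_inl_inr (p q a b : Fin 2) : boostGen p q (Sum.inl a) (Sum.inr b) = if a = p ∧ b = q then -I else 0 := rfl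

/-- the `(q̄, p)` entry of `Y_{pq}` is `i`. [folklore] -/
@[simp] theorem boostGen_inr_inl (p q a b : Fin 2) : boostGen p q (Sum.inr b) (Sum.inl a) = if a = p ∧ b = q then I else 0 := rfl

/-- frame diagonalising `Y_{pq}`: columns `(−i, 1)`, `(i, 1)` (eigenvalues `1`, `−1` of `(0, −i; i, 0)`) planted on the plane `{e_p, e_q̄}`,
the identity elsewhere. [folklore] -/
def boostGenFrame (p q : Fin 2) : Matrix (Fin 2 ⊕ Fin 2) (Fin 2 ⊕ Fin 2) ℂ := plant p q !![-I, I; 1, 1]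

/-- its inverse `(i∕2, 1∕2; −i∕2, 1∕2)` planted on `{e_p, e_q̄}`. [folklore] -/
def boostGenFrameInv (p q : Fin 2) : Matrix (Fin 2 ⊕ Fin 2) (Fin 2 ⊕ Fin 2) ℂ := plant p q !![I / 2, 1 / 2; -I / 2, 1 / 2]

/-- the eigenvalue profile of `s · Y_{pq}`: `s` at `e_p`, `−s` at `e_q̄`, `0` elsewhere. [folklore] -/
def boostGenDiag (p q : Fin 2) (s : ℝ) : Fin 2 ⊕ Fin 2 → ℂ :=
  Sum.elim (fun a => if a = p then (s : ℂ) else 0) (fun b => if b = q then -(s : ℂ) else 0)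

/-- `R R⁻¹ = 1`. [folklore] -/
theorem boostGenFrame_mul_inv (p q : Fin 2) : boostGenFrame p q * boostGenFrameInv p q = 1 := by
  rw [boostGenFrame, boostGenFrameInv, ← RealDualPair.plant_mul, ← RealDualPair.plant_one p q]
  congr 1
  ext i j
  fin_cases i <;> fin_cases j <;> simp [Matrix.mul_apply, Fin.sum_univ_two] <;>
    (first | ring1 | (ring_nf; simp only [Complex.I_sq]; ring_nf))

/-- `R` is invertible. [folklore] -/
theorem isUnit_boostGenFrame (p q : Fin 2) : IsUnit (boostGenFrame p q) :=
  letI := invertibleOfRightInverse _ _ (boostGenFrame_mul_inv p q)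
  isUnit_of_invertible _

/-- the nonsingular inverse of `R` is `boostGenFrameInv`. [folklore] -/
theorem boostGenFrame_inv (p q : Fin 2) : (boostGenFrame p q)⁻¹ = boostGenFrameInv p q :=
  Matrix.inv_eq_right_inv (boostGenFrame_mul_inv p q)

/-- `s · Y_{pq} = R · diag · R⁻¹`. [folklore] -/
theorem smul_boostGen_eq_conj (p q : Fin 2) (s : ℝ) :
    s • boostGen p q = boostGenFrame p q * Matrix.diagonal (boostGenDiag p q s) * (boostGenFrame p q)⁻¹ := by
  rw [boostGenFrame_inv p q]
  ext x y
  rcases x with a | b <;> rcases y with a' | b'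
  · fin_cases p <;> fin_cases q <;> fin_cases a <;> fin_cases a' <;>
      simp [boostGenFrame, boostGenFrameInv, boostGenDiag, Matrix.mul_apply, Fintype.sum_sum_type, Fin.sum_univ_two, Matrix.diagonal] <;>
        ring1
  · fin_cases p <;> fin_cases q <;> fin_cases a <;> fin_cases b' <;>
      simp [boostGenFrame, boostGenFrameInv, boostGenDiag, Matrix.mul_apply, Fintype.sum_sum_type, Fin.sum_univ_two, Matrix.diagonal,
        Complex.real_smul] <;>
        ring1
  · fin_cases p <;> fin_cases q <;> fin_cases b <;> fin_cases a' <;>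
      simp [boostGenFrame, boostGenFrameInv, boostGenDiag, Matrix.mul_apply, Fintype.sum_sum_type, Fin.sum_univ_two, Matrix.diagonal,
        Complex.real_smul] <;>
        ring1
  · fin_cases p <;> fin_cases q <;> fin_cases b <;> fin_cases b' <;>
      simp [boostGenFrame, boostGenFrameInv, boostGenDiag, Matrix.mul_apply, Fintype.sum_sum_type, Fin.sum_univ_two, Matrix.diagonal]

set_option maxHeartbeats 400000 in
/-- **The hyperbolic one-parameter groups are exponentials**: `exp (s · Y_{pq}) = hypV p q s` as matrices (★ `coe_hypV`:
`plant p q (cosh s, −i sinh s; i sinh s, cosh s)`). [cite: Knapp2002, VI.§2] -/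
theorem exp_smul_boostGen (p q : Fin 2) (s : ℝ) :
    exp (s • boostGen p q) = (((hypV p q s : UForm (Fin 2) (Fin 2)) : GL (Fin 2 ⊕ Fin 2) ℂ) : Matrix (Fin 2 ⊕ Fin 2) (Fin 2 ⊕ Fin 2) ℂ) := by
  have hexp : ∀ z : ℂ, exp z = Complex.exp z := fun z => by rw [Complex.exp_eq_exp_ℂ]
  rw [smul_boostGen_eq_conj, Matrix.exp_conj _ _ (isUnit_boostGenFrame p q), Matrix.exp_diagonal, boostGenFrame_inv p q, Pi.exp_def,
    coe_hypV]
  ext x y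
  rcases x with a | b <;> rcases y with a' | b'
  · fin_cases p <;> fin_cases q <;> fin_cases a <;> fin_cases a' <;>
      simp [boostGenFrame, boostGenFrameInv, boostGenDiag, Matrix.mul_apply, Fintype.sum_sum_type, Fin.sum_univ_two, Matrix.diagonal, hexp,
        Real.cosh_eq, Complex.ofReal_exp] <;>
        (ring_nf; simp only [Complex.I_sq]; ring_nf)
  · fin_cases p <;> fin_cases q <;> fin_cases a <;> fin_cases b' <;>
      simp [boostGenFrame, boostGenFrameInv, boostGenDiag, Matrix.mul_apply, Fintype.sum_sum_type, Fin.sum_univ_two, Matrix.diagonal, hexp,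
        Real.sinh_eq, Complex.ofReal_exp] <;>
        ring1
  · fin_cases p <;> fin_cases q <;> fin_cases b <;> fin_cases a' <;>
      simp [boostGenFrame, boostGenFrameInv, boostGenDiag, Matrix.mul_apply, Fintype.sum_sum_type, Fin.sum_univ_two, Matrix.diagonal, hexp,
        Real.sinh_eq, Complex.ofReal_exp] <;>
        ring1
  · fin_cases p <;> fin_cases q <;> fin_cases b <;> fin_cases b' <;>
      simp [boostGenFrame, boostGenFrameInv, boostGenDiag, Matrix.mul_apply, Fintype.sum_sum_type, Fin.sum_univ_two, Matrix.diagonal, hexp,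
        Real.cosh_eq, Complex.ofReal_exp] <;>
        ring1

/-- `exp (s · Y_{pq}) ∈ U(2,2)` for all `s`. [folklore] -/
theorem expGL_smul_boostGen_mem (p q : Fin 2) (s : ℝ) : expGL (s • boostGen p q) ∈ (uFormGroup (Fin 2) (Fin 2)).carrier := by
  have h : expGL (s • boostGen p q) = ((hypV p q s : UForm (Fin 2) (Fin 2)) : GL (Fin 2 ⊕ Fin 2) ℂ) := Units.ext (exp_smul_boostGen p q s)
  rw [h]
  exact (hypV p q s).2

/-- **`Y_{pq} ∈ 𝔲(2,2)`** (by regularity ★ `uFormGroup_regular`: all its exponentials lie in `U(2,2)`). [cite: Knapp2002, I.§1 Example (3)] -/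
theorem boostGen_mem_lie (p q : Fin 2) : boostGen p q ∈ (uFormGroup (Fin 2) (Fin 2)).lie :=
  uFormGroup_regular _ fun t => expGL_smul_boostGen_mem p q t

/-- **The real boost generator** `Z_{pq} = E_{p,q̄} + E_{q̄,p} = Ad(d_p) Y_{pq}` (`d_p = diag(i at p)`). [folklore] -/
def realBoostGen (p q : Fin 2) : Matrix (Fin 2 ⊕ Fin 2) (Fin 2 ⊕ Fin 2) ℂ :=
  Matrix.of fun x y =>
    match x, y with
    | Sum.inl a, Sum.inr b => if a = p ∧ b = q then 1 else 0
    | Sum.inr b, Sum.inl a => if a = p ∧ b = q then 1 else 0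
    | _, _ => 0

/-- `Z_{pq}` vanishes on the `α × α` block. [folklore] -/
@[simp] theorem realBoostGen_inl_inl (p q a a' : Fin 2) : realBoostGen p q (Sum.inl a) (Sum.inl a') = 0 := rfl

/-- `Z_{pq}` vanishes on the `β × β` block. [folklore] -/
@[simp] theorem realBoostGen_inr_inr (p q b b' : Fin 2) : realBoostGen p q (Sum.inr b) (Sum.inr b') = 0 := rfl

/-- the `(p, q̄)` entry of `Z_{pq}` is `1`. [folklore] -/
@[simp] theorem realBoostGen_inl_inr (p q a b : Fin 2) : realBoostGen p q (Sum.inl a) (Sum.inr b) = if a = p ∧ b = q then 1 else 0 := rfl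

/-- the `(q̄, p)` entry of `Z_{pq}` is `1`. [folklore] -/
@[simp] theorem realBoostGen_inr_inl (p q a b : Fin 2) : realBoostGen p q (Sum.inr b) (Sum.inl a) = if a = p ∧ b = q then 1 else 0 := rfl

end Boost

/-! ## §2 Letters: boosts `hypV p q` and compact tori -/

section Letters

/-- **The two kinds of letters** of the adapted basis of `𝔲(2,2)`: a boost `hypV p q` in the plane `{e_p, e_q̄}`, or a compact torus with rates
`(a, b)`. [folklore] -/
inductive LetterKind : Type
  /-- the boost `s ↦ hypV p q s` -/
  | boost (p q : Fin 2)
  /-- the compact torus `s ↦ kV (diagHom (torusPt (s • a)), diagHom (torusPt (s • b)))` -/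
  | torus (a b : Fin 2 → ℝ)

/-- **The one-parameter group of a letter**: `boost p q ↦ hypV p q`, `torus a b ↦ torusOneParam a b`. [folklore] -/
def letterOf : LetterKind → ℝ → UForm (Fin 2) (Fin 2)
  | .boost p q => hypV p q
  | .torus a b => torusOneParam a b

/-- `letterOf (boost p q) = hypV p q`. [folklore] -/
@[simp] theorem letterOf_boost (p q : Fin 2) : letterOf (.boost p q) = hypV p q := rfl

/-- `letterOf (torus a b) s = kV (diagHom (torusPt (s • a)), diagHom (torusPt (s • b)))`. [folklore] -/
@[simp] theorem letterOf_torus (a b : Fin 2 → ℝ) (s : ℝ) :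
    letterOf (.torus a b) s = kV (Fin 2) (Fin 2) (diagHom (torusPt (s • a)), diagHom (torusPt (s • b))) := rfl

/-- **The generator of a letter**: `boost p q ↦ Y_{pq}`, `torus a b ↦ torusGen a b`. [folklore] -/
def letterGen : LetterKind → Matrix (Fin 2 ⊕ Fin 2) (Fin 2 ⊕ Fin 2) ℂ
  | .boost p q => boostGen p q
  | .torus a b => torusGen a b

/-- `letterGen (boost p q) = Y_{pq}`. [folklore] -/
@[simp] theorem letterGen_boost (p q : Fin 2) : letterGen (.boost p q) = boostGen p q := rfl

/-- `letterGen (torus a b) = torusGen a b`. [folklore] -/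
@[simp] theorem letterGen_torus (a b : Fin 2 → ℝ) : letterGen (.torus a b) = torusGen a b := rfl

/-- the generator of a letter lies in `𝔲(2,2)`. [folklore] -/
theorem letterGen_mem_lie (k : LetterKind) : letterGen k ∈ (uFormGroup (Fin 2) (Fin 2)).lie := by
  cases k with
  | boost p q => exact boostGen_mem_lie p q
  | torus a b => exact torusGen_mem_lie a b

/-- **`exp (s · letterGen k) = letterOf k s`**: the letter is the one-parameter group of its generator. [folklore] -/
theorem exp_smul_letterGen (k : LetterKind) (s : ℝ) :
    exp (s • letterGen k) = (((letterOf k s : UForm (Fin 2) (Fin 2)) : GL (Fin 2 ⊕ Fin 2) ℂ) : Matrix (Fin 2 ⊕ Fin 2) (Fin 2 ⊕ Fin 2) ℂ) := by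
  cases k with
  | boost p q => exact exp_smul_boostGen p q s
  | torus a b => exact exp_smul_torusGen a b s

end Letters

/-! ## §3 The sixteen generators `X_i = g_i X⁰_i g_i⁻¹` and their exponential table -/

section Generators

/-- **The letter kinds of the sixteen generators**: tori `iE₀₀, iE₁₁, iE₂₂, iE₃₃` (rates `(−1,0|0,0)`, `(0,−1|0,0)`, `(0,0|−1,0)`, `(0,0|0,−1)`), twice the
torus `i(E₀₀ − E₁₁)` and twice `i(E₂₂ − E₃₃)` (to be rotated into the off-diagonal compact directions), the boosts `Y₀₀, Y₀₁, Y₁₀, Y₁₁` and again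
`Y₀₀, Y₀₁, Y₁₀, Y₁₁` (to be phased into the real boosts). [folklore] -/
def u22Kind : Fin 16 → LetterKind :=
  ![.torus ![-1, 0] 0, .torus ![0, -1] 0, .torus 0 ![-1, 0], .torus 0 ![0, -1],
    .torus ![-1, 1] 0, .torus ![-1, 1] 0, .torus 0 ![-1, 1], .torus 0 ![-1, 1],
    .boost 0 0, .boost 0 1, .boost 1 0, .boost 1 1,
    .boost 0 0, .boost 0 1, .boost 1 0, .boost 1 1]

/-- **The `K`-frames of the sixteen generators** (`K = U(2) × U(2)`): `1` ×4; `(w, 1)`, `(d₁w, 1)`, `(1, w)`, `(1, d₁w)`; `1` ×4; `(d₀, 1)`, `(d₀, 1)`,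
`(d₁, 1)`, `(d₁, 1)` — `w = (1∕5)(3, 4; −4, 3)` (★ `rotW`), `d_p = diag(i at p)` (★ `phaseDiag p`). [folklore] -/
def u22FrameK : Fin 16 → Matrix.unitaryGroup (Fin 2) ℂ × Matrix.unitaryGroup (Fin 2) ℂ :=
  ![1, 1, 1, 1, (rotW, 1), (phaseDiag 1 * rotW, 1), (1, rotW), (1, phaseDiag 1 * rotW),
    1, 1, 1, 1, (phaseDiag 0, 1), (phaseDiag 0, 1), (phaseDiag 1, 1), (phaseDiag 1, 1)]

/-- **The base directions** `X⁰_i = letterGen (u22Kind i)`. [folklore] -/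
def u22BaseGen (i : Fin 16) : Matrix (Fin 2 ⊕ Fin 2) (Fin 2 ⊕ Fin 2) ℂ :=
  letterGen (u22Kind i)

/-- **The conjugators** `g_i = kV (u22FrameK i) ∈ K`. [folklore] -/
def u22AdaptedConj (i : Fin 16) : UForm (Fin 2) (Fin 2) :=
  kV (Fin 2) (Fin 2) (u22FrameK i)

/-- `g_i ∈ kV (U(2) × U(2))`. [folklore] -/
theorem u22AdaptedConj_mem_range (i : Fin 16) : u22AdaptedConj i ∈ Set.range (kV (Fin 2) (Fin 2)) :=
  ⟨u22FrameK i, rfl⟩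

/-- **The base one-parameter groups** `L_i = letterOf (u22Kind i) : ℝ → U(2,2)`. [folklore] -/
def u22AdaptedOneParam (i : Fin 16) : ℝ → UForm (Fin 2) (Fin 2) :=
  letterOf (u22Kind i)

/-- **The adapted generators** `X_i = g_i X⁰_i g_i⁻¹` of `𝔲(2,2)` (`i < 16`). [cite: Knapp2002, VI.§2] -/
def u22Gen (i : Fin 16) : Matrix (Fin 2 ⊕ Fin 2) (Fin 2 ⊕ Fin 2) ℂ :=
  (((u22AdaptedConj i : UForm (Fin 2) (Fin 2)) : GL (Fin 2 ⊕ Fin 2) ℂ) : Matrix (Fin 2 ⊕ Fin 2) (Fin 2 ⊕ Fin 2) ℂ) *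
    u22BaseGen i *
    ((((u22AdaptedConj i : UForm (Fin 2) (Fin 2)) : GL (Fin 2 ⊕ Fin 2) ℂ)⁻¹ : GL (Fin 2 ⊕ Fin 2) ℂ) : Matrix (Fin 2 ⊕ Fin 2) (Fin 2 ⊕ Fin 2) ℂ)

/-- the base directions lie in `𝔲(2,2)`. [folklore] -/
theorem u22BaseGen_mem_lie (i : Fin 16) : u22BaseGen i ∈ (uFormGroup (Fin 2) (Fin 2)).lie :=
  letterGen_mem_lie _

/-- **`X_i ∈ 𝔲(2,2)`** (`Ad K`-stability of `𝔲(2,2)`). [cite: Knapp2002, I.§1 Example (3)] -/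
theorem u22Gen_mem_lie (i : Fin 16) : u22Gen i ∈ (uFormGroup (Fin 2) (Fin 2)).lie :=
  (uFormGroup (Fin 2) (Fin 2)).conj_mem_lie _ (u22AdaptedConj i).2 _ (u22BaseGen_mem_lie i)

/-- the base one-parameter groups are the exponentials of the base directions: `exp (s X⁰_i) = L_i(s)`. [folklore] -/
theorem exp_smul_u22BaseGen (i : Fin 16) (s : ℝ) :
    exp (s • u22BaseGen i) =
      (((u22AdaptedOneParam i s : UForm (Fin 2) (Fin 2)) : GL (Fin 2 ⊕ Fin 2) ℂ) : Matrix (Fin 2 ⊕ Fin 2) (Fin 2 ⊕ Fin 2) ℂ) :=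
  exp_smul_letterGen _ s

/-- **The exponential table** (matrix form): `exp (s X_i) = g_i L_i(s) g_i⁻¹`. [cite: Knapp2002, VI.§2] -/
theorem exp_smul_u22Gen (i : Fin 16) (s : ℝ) :
    exp (s • u22Gen i) =
      (((u22AdaptedConj i * u22AdaptedOneParam i s * (u22AdaptedConj i)⁻¹ : UForm (Fin 2) (Fin 2)) :
        GL (Fin 2 ⊕ Fin 2) ℂ) : Matrix (Fin 2 ⊕ Fin 2) (Fin 2 ⊕ Fin 2) ℂ) := by
  rw [u22Gen, ← Matrix.smul_mul, ← Matrix.mul_smul, Matrix.exp_units_conj, exp_smul_u22BaseGen]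
  rfl

/-- **The exponential table** (`GL` form): `expGL (s X_i) = g_i L_i(s) g_i⁻¹` in `GL₄(ℂ)`. [folklore] -/
theorem expGL_smul_u22Gen (i : Fin 16) (s : ℝ) :
    expGL (s • u22Gen i) =
      ((u22AdaptedConj i * u22AdaptedOneParam i s * (u22AdaptedConj i)⁻¹ : UForm (Fin 2) (Fin 2)) : GL (Fin 2 ⊕ Fin 2) ℂ) :=
  Units.ext (exp_smul_u22Gen i s)

/-- **The exponential table** (`GL` form, letters spelled out):
`expGL (s X_i) = kV (u22FrameK i) * letterOf (u22Kind i) s * (kV (u22FrameK i))⁻¹`. [folklore] -/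
theorem expGL_smul_u22Gen_eq (i : Fin 16) (s : ℝ) :
    expGL (s • u22Gen i) =
      ((kV (Fin 2) (Fin 2) (u22FrameK i) * letterOf (u22Kind i) s * (kV (Fin 2) (Fin 2) (u22FrameK i))⁻¹ :
        UForm (Fin 2) (Fin 2)) : GL (Fin 2 ⊕ Fin 2) ℂ) :=
  expGL_smul_u22Gen i s

/-- `exp (s X_i) ∈ U(2,2)`. [folklore] -/
theorem expGL_smul_u22Gen_mem (i : Fin 16) (s : ℝ) : expGL (s • u22Gen i) ∈ (uFormGroup (Fin 2) (Fin 2)).carrier := by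
  rw [expGL_smul_u22Gen]
  exact (u22AdaptedConj i * u22AdaptedOneParam i s * (u22AdaptedConj i)⁻¹).2

end Generators

end Summit.HodgeConjecture.HodgeConjecture.Cruxes.HLiu418.K2LiuU22AdaptedBasis

end
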